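import Mathlib
import Summits.NavierStokesRegularity.NavierStokesRegularity.Theorems.EulerZoomLiouvillePowerGaugeEulerLiouvilleSelfSimilarBernoulliPiercing
import HarnessLib.Audit

/-!
# Crux `EulerZoomLiouville.PowerGaugeEulerLiouville` (stmt-NavierStokesRegularity-19832), THE ONE STATEMENT `stub_selfSimilarC2Needle`:
# FEEDING FROM INFINITY, BY NAME — every vortical point is fed, through EVERY larger sphere, by a fast-inflow point that is vortical and Bernoulli-higher

Route №10 `EulerZoomLiouville` (NavierStokesRegularity), crux E = stmt-NavierStokesRegularity-19832; LEAD ns-typeII-p2 g11 key (L2) (RESIDUE-MEMO-19832-g11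
§0 (F2)); width seat ns-ezl-w6.  The POINTWISE portrait behind the LEAD's `Loc.curl_eq_zero_of_piercingBernoulli` (`…SelfSimilarBernoulliPiercing`,
p624179): for a `C²` profile `(U, P)` of CIV (3.3) with `0 < γ < ½`, Bernoulli function `ℋ = selfSimilarBernoulli γ 0 U P` and transport field
`W = γy + U`,

> (`Loc.exists_fastInflow_vortical_bernoulli_gt`) if `curl U x₀ ≠ 0`, `h < ℋ(x₀)` and `R > ‖x₀‖`, then the sphere `‖y‖ = R` carries a point `y` with
> FAST INFLOW `⟪y, U y⟫ ≤ −γ‖y‖²` (i.e. `⟪y, W y⟫ ≤ 0`), VORTICITY `curl U y ≠ 0`, and `ℋ(y) > h`.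

Proof (the body of `curl_eq_zero_of_piercingBernoulli`, run by contradiction at THIS fixed `R`): if every fast-inflow vortical point of the sphere had
`ℋ ≤ h`, take `r > 0` with `B(x₀, r) ⊆ B_R ∩ {ℋ > h}`; the backward similarity orbit of a vortical `x ∈ B(x₀, r)` is either CONFINED in `B̄_R`
(a null set of starting points, `volume_vortical_confined_eq_zero`) or EXITS first at a point `y₁` of the sphere, which is fast-inflow (one-sided Fermat
for `‖Y‖²`), hence either irrotational — transported back to `x` by the linear Cauchy equation for `e^{−(1+γ)s} curl U(Y s)`, contradiction — or vortical
with `ℋ(y₁) ≤ h < ℋ(x) ≤ ℋ(y₁)` by the backward monotonicity of `ℋ` (`selfSimilarBernoulli_monotone_backward`, CIV (3.31)) — contradiction.  So the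
open set `B(x₀, r) ∩ {curl U ≠ 0}` is null, hence empty; but it contains `x₀`.

WHAT THIS IS NOT: not NS, not E — a pointwise portrait lemma for THE ONE STATEMENT's needle (input (F2) of the LEAD's channel calculus);
`--supports` stmt-19832; 19832 is OPEN. [folklore; ConstantinIgnatovaVicol2026Putative §3.4.3 (3.30)–(3.33), §3.5]
-/

noncomputable section

set_option linter.dupNamespace false

open MeasureTheory Set Filter Topology Metric Function InnerProductSpace
open scoped RealInnerProductSpace NNReal ENNReal ContDiff

namespace Summit.NavierStokesRegularity.NavierStokesRegularity.Theorems.PowerGaugeEulerLiouville.Loc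

open Literature.Analysis Literature.Analysis.FluidPDE
open Summit.NavierStokesRegularity.NavierStokesRegularity.Theorems.PowerGaugeEulerLiouville.Kelvin
open Summit.NavierStokesRegularity.NavierStokesRegularity.Theorems.PowerGaugeEulerLiouville.NodalFiniteness

variable {γ : ℝ} {U : EuclideanSpace ℝ (Fin 3) → EuclideanSpace ℝ (Fin 3)} {P : EuclideanSpace ℝ (Fin 3) → ℝ}

/-- **FEEDING FROM INFINITY, BY NAME.**  `(U, P)` a `C²` profile of CIV (3.3) with `0 < γ < ½`, `ℋ = selfSimilarBernoulli γ 0 U P`.  If `curl U x₀ ≠ 0`,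
`h < ℋ x₀` and `‖x₀‖ < R`, then some `y` with `‖y‖ = R` has `⟪y, U y⟫ ≤ −γ‖y‖²` (fast inflow), `curl U y ≠ 0` and `h < ℋ y`.  (First exit of backward
similarity orbits from `B_R` + transport of vanishing vorticity + backward monotonicity of `ℋ` + null confined set; the pointwise form of
`curl_eq_zero_of_piercingBernoulli`.) [folklore; cf. ConstantinIgnatovaVicol2026Putative §3.4.3] -/
theorem exists_fastInflow_vortical_bernoulli_gt (hprof : IsSelfSimilarEulerProfile γ 0 U P) (hγ : 0 < γ) (hγ2 : γ < 1 / 2)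
    {x₀ : EuclideanSpace ℝ (Fin 3)} (hx₀ : curl U x₀ ≠ 0) {h : ℝ} (hh : h < selfSimilarBernoulli γ 0 U P x₀)
    {R : ℝ} (hR : ‖x₀‖ < R) :
    ∃ y : EuclideanSpace ℝ (Fin 3), ‖y‖ = R ∧ ⟪y, U y⟫ ≤ -(γ * ‖y‖ ^ 2) ∧ curl U y ≠ 0 ∧
      h < selfSimilarBernoulli γ 0 U P y := by
  -- adapted from `curl_eq_zero_of_piercingBernoulli` (…SelfSimilarBernoulliPiercing, p624179; LEAD ns-typeII-p2 g11), run at a fixed radius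
  by_contra hne
  push Not at hne
  have hU2 : ContDiff ℝ 2 U := hprof.contDiff_velocity
  have hU1 : ContDiff ℝ 1 U := hU2.of_le (by norm_num)
  set Hb : EuclideanSpace ℝ (Fin 3) → ℝ := selfSimilarBernoulli γ 0 U P with hHb
  have hHc : Continuous Hb := hprof.contDiff_selfSimilarBernoulli.continuous
  have hR0 : 0 < R := lt_of_le_of_lt (norm_nonneg _) hR
  -- a radius `r_h` with `ℋ > h` on `B(x₀, r_h)`
  have hev : ∀ᶠ x in 𝓝 x₀, h < Hb x := (hHc.continuousAt (x := x₀)).eventually (lt_mem_nhds hh)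
  obtain ⟨rh, hrh, hball⟩ := Metric.eventually_nhds_iff.1 hev
  -- the working ball `B(x₀, r)`, `r = min (R − ‖x₀‖) r_h / 2`
  set r : ℝ := min (R - ‖x₀‖) rh / 2 with hr
  have hr0 : 0 < r := by
    rw [hr]; exact div_pos (lt_min (by linarith) hrh) two_pos
  have hrR : r < R - ‖x₀‖ := by
    have : min (R - ‖x₀‖) rh ≤ R - ‖x₀‖ := min_le_left _ _
    rw [hr]; linarith [lt_min (show (0 : ℝ) < R - ‖x₀‖ by linarith) hrh]
  have hrh' : r < rh := by
    have : min (R - ‖x₀‖) rh ≤ rh := min_le_right _ _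
    rw [hr]; linarith [lt_min (show (0 : ℝ) < R - ‖x₀‖ by linarith) hrh]
  have hgt : ∀ x : EuclideanSpace ℝ (Fin 3), dist x x₀ < r → h < Hb x :=
    fun x hx => hball (hx.trans hrh')
  -- the cutoff field, `= U` on `ball 0 (R + 1)`
  obtain ⟨V, hV, ⟨M, hVM⟩, -, ⟨K, hK⟩, hagree⟩ := exists_cutoff_local_smul hU2 (R := R + 1) (by linarith)
  have hV1 : ContDiff ℝ 1 V := hV.of_le (by norm_num)
  have hnear : ∀ z : EuclideanSpace ℝ (Fin 3), ‖z‖ ≤ R → V =ᶠ[𝓝 z] U := by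
    intro z hz
    have hmem : ball (0 : EuclideanSpace ℝ (Fin 3)) (R + 1) ∈ 𝓝 z :=
      isOpen_ball.mem_nhds (by rw [mem_ball, dist_zero_right]; linarith)
    exact Filter.eventually_of_mem hmem fun y hy => hagree y hy
  have hDeq : ∀ z : EuclideanSpace ℝ (Fin 3), ‖z‖ ≤ R → fderiv ℝ V z = fderiv ℝ U z :=
    fun z hz => (hnear z hz).fderiv_eq
  have hWeq : ∀ z : EuclideanSpace ℝ (Fin 3), ‖z‖ ≤ R →
      selfSimilarTransport γ 0 V z = selfSimilarTransport γ 0 U z := by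
    intro z hz
    simp only [selfSimilarTransport_apply, hagree z (by rw [mem_ball, dist_zero_right]; linarith)]
  set Φ := ODE.evolutionMap (fun _ : ℝ => selfSimilarTransport γ 0 V) 0 with hΦ
  -- every vortical point of `B(x₀, r)` has a confined backward `U`-half-orbit
  have hsubset : {x : EuclideanSpace ℝ (Fin 3) | dist x x₀ < r ∧ curl U x ≠ 0} ⊆
      {x : EuclideanSpace ℝ (Fin 3) | curl U x ≠ 0 ∧
        ∃ Y : ℝ → EuclideanSpace ℝ (Fin 3), Y 0 = x ∧
          (∀ t, 0 ≤ t → HasDerivAt Y ((-1 : ℝ) • selfSimilarTransport γ 0 U (Y t)) t) ∧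
          ∀ t, 0 ≤ t → ‖Y t‖ ≤ R} := by
    rintro x ⟨hx, hcx⟩
    have hxR : ‖x‖ < R := by
      have := norm_le_norm_add_norm_sub' x x₀
      rw [← dist_eq_norm] at this
      linarith
    have hHx : h < Hb x := hgt x hx
    set Yp : ℝ → EuclideanSpace ℝ (Fin 3) := fun t => Φ (-t) x with hYp
    have hYpV : ∀ t, HasDerivAt Yp ((-1 : ℝ) • selfSimilarTransport γ 0 V (Yp t)) t :=
      fun t => C2.Kelvin.hasDerivAt_flow_neg (γ := γ) hV1 hK x t
    have hYpc : Continuous Yp := continuous_iff_continuousAt.2 fun t => (hYpV t).continuousAt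
    have hYp0 : Yp 0 = x := by simp [hYp, hΦ, ODE.evolutionMap_self]
    have hYpU : ∀ t, ‖Yp t‖ ≤ R → HasDerivAt Yp ((-1 : ℝ) • selfSimilarTransport γ 0 U (Yp t)) t := by
      intro t ht
      have h := hYpV t
      rwa [hWeq (Yp t) ht] at h
    by_cases hconf : ∀ t, 0 ≤ t → ‖Yp t‖ ≤ R
    · exact ⟨hcx, Yp, hYp0, fun t ht => hYpU t (hconf t ht), hconf⟩
    -- otherwise: FIRST EXIT through the sphere `‖y‖ = R`
    exfalso
    push Not at hconf
    obtain ⟨t₂, ht₂0, ht₂R⟩ := hconf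
    set T : Set ℝ := {t | 0 ≤ t ∧ R ≤ ‖Yp t‖} with hT
    have hTne : T.Nonempty := ⟨t₂, ht₂0, ht₂R.le⟩
    have hTcl : IsClosed T := by
      rw [hT, setOf_and]
      exact (isClosed_le continuous_const continuous_id).inter (isClosed_le continuous_const hYpc.norm)
    have hTbdd : BddBelow T := ⟨0, fun t ht => ht.1⟩
    set t₁ : ℝ := sInf T with ht₁
    have ht₁T : t₁ ∈ T := hTcl.csInf_mem hTne hTbdd
    have ht₁0 : 0 ≤ t₁ := ht₁T.1
    have hbefore : ∀ t, 0 ≤ t → t < t₁ → ‖Yp t‖ < R := by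
      intro t ht0 htlt
      by_contra hge
      push Not at hge
      have : t₁ ≤ t := csInf_le hTbdd ⟨ht0, hge⟩
      linarith
    have ht₁pos : 0 < t₁ := by
      rcases ht₁0.lt_or_eq with h1 | h1
      · exact h1
      · exfalso
        have := ht₁T.2
        rw [← h1, hYp0] at this
        linarith
    -- `‖Yp t₁‖ = R` (continuity from the left)
    have hnorm₁ : ‖Yp t₁‖ = R := by
      refine le_antisymm ?_ ht₁T.2
      by_contra hgt'
      push Not at hgt'
      have hev' : ∀ᶠ t in 𝓝 t₁, R < ‖Yp t‖ :=
        (hYpc.norm.continuousAt (x := t₁)).eventually (lt_mem_nhds hgt')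
      obtain ⟨δ, hδ, hball'⟩ := Metric.eventually_nhds_iff.1 hev'
      set t : ℝ := max (t₁ - δ / 2) 0 with htdef
      have ht0 : 0 ≤ t := le_max_right _ _
      have htlt : t < t₁ := by
        rw [htdef]; exact max_lt (by linarith) ht₁pos
      have hdist : dist t t₁ < δ := by
        rw [dist_comm, Real.dist_eq, abs_of_nonneg (by linarith)]
        have : t₁ - δ / 2 ≤ t := le_max_left _ _
        linarith
      have h1 := hball' hdist
      have h2 := hbefore t ht0 htlt
      linarith
    have hin : ∀ t ∈ Icc 0 t₁, ‖Yp t‖ ≤ R := by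
      intro t ht
      rcases ht.2.lt_or_eq with h1 | h1
      · exact (hbefore t ht.1 h1).le
      · rw [h1, hnorm₁]
    -- Fermat at the one-sided maximum of `g = ‖Yp‖²` on `[0, t₁]`: `g′(t₁) ≥ 0`
    set g : ℝ → ℝ := fun t => ‖Yp t‖ ^ 2 with hg
    have hg' : HasDerivAt g (2 * ⟪Yp t₁, (-1 : ℝ) • selfSimilarTransport γ 0 V (Yp t₁)⟫) t₁ := (hYpV t₁).norm_sq
    have hmax : IsLocalMaxOn g (Icc 0 t₁) t₁ := by
      refine Filter.eventually_of_mem self_mem_nhdsWithin fun t ht => ?_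
      show ‖Yp t‖ ^ 2 ≤ ‖Yp t₁‖ ^ 2
      rw [hnorm₁]
      exact pow_le_pow_left₀ (norm_nonneg _) (hin t ht) 2
    have hcone : -t₁ ∈ posTangentConeAt (Icc (0 : ℝ) t₁) t₁ := by
      refine mem_posTangentConeAt_of_segment_subset ?_
      rw [show t₁ + -t₁ = (0 : ℝ) by ring, segment_symm, segment_eq_Icc ht₁0]
    have hfermat := hmax.hasFDerivWithinAt_nonpos hg'.hasFDerivAt.hasFDerivWithinAt hcone
    -- so `⟪Y, W(Y)⟫ ≤ 0` at the exit point: a fast-inflow point of the sphere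
    have hWY : ⟪Yp t₁, selfSimilarTransport γ 0 U (Yp t₁)⟫ ≤ 0 := by
      rw [← hWeq (Yp t₁) hnorm₁.le]
      have h1 : (-t₁) • (2 * ⟪Yp t₁, (-1 : ℝ) • selfSimilarTransport γ 0 V (Yp t₁)⟫) ≤ 0 := by
        simpa using hfermat
      rw [inner_smul_right, smul_eq_mul] at h1
      nlinarith
    have hfast : ⟪Yp t₁, U (Yp t₁)⟫ ≤ -(γ * ‖Yp t₁‖ ^ 2) := by
      rw [selfSimilarTransport_apply, sub_zero, inner_add_right, inner_smul_right, real_inner_self_eq_norm_sq] at hWY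
      linarith
    -- the exit point is irrotational: a vortical exit would be Bernoulli-low (`hne`), against the monotonicity of `ℋ`
    have hcurl₁ : curl U (Yp t₁) = 0 := by
      by_contra hc1
      have hlow : Hb (Yp t₁) ≤ h := hne (Yp t₁) hnorm₁ hfast hc1
      have hmono := selfSimilarBernoulli_monotone_backward hprof hγ2.le ht₁0
        (fun t ht => hYpU t (hin t ht))
      have hx0 : h < Hb (Yp 0) := by rw [hYp0]; exact hHx
      have hm : Hb (Yp 0) ≤ Hb (Yp t₁) := hmono
      linarith
    -- transport the zero back to `x` along the `U`-orbit: linear Cauchy equation + uniqueness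
    set A : ℝ → EuclideanSpace ℝ (Fin 3) →L[ℝ] EuclideanSpace ℝ (Fin 3) :=
      fun t => (-1 : ℝ) • fderiv ℝ (selfSimilarTransport γ 0 U) (Yp t) with hA
    set u : ℝ → EuclideanSpace ℝ (Fin 3) := fun s => Real.exp ((-1 : ℝ) * (1 + γ) * s) • curl U (Yp s) with hu
    have hu' : ∀ t ∈ Icc 0 t₁, HasDerivAt u (A t (u t)) t := fun t ht =>
      hasDerivAt_weightedCurl_comp hprof (hYpU t (hin t ht))
    have hKV : ∀ t ∈ Icc 0 t₁, LipschitzOnWith (Real.toNNReal (|γ| + K))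
        (fun w : EuclideanSpace ℝ (Fin 3) => A t w) univ := by
      intro t ht
      refine ((A t).lipschitz.weaken ?_).lipschitzOnWith
      have hK0 : 0 ≤ K := (norm_nonneg _).trans (hK 0)
      rw [← NNReal.coe_le_coe, coe_nnnorm, Real.coe_toNNReal _ (add_nonneg (abs_nonneg γ) hK0)]
      calc ‖A t‖ = ‖fderiv ℝ (selfSimilarTransport γ 0 U) (Yp t)‖ := by
            show ‖(-1 : ℝ) • fderiv ℝ (selfSimilarTransport γ 0 U) (Yp t)‖ = _
            rw [norm_smul, norm_neg, norm_one, one_mul]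
        _ ≤ |γ| + K := by
            rw [fderiv_transport_eq hprof (Yp t)]
            refine (norm_add_le _ _).trans (add_le_add ?_ ?_)
            · rw [norm_smul, Real.norm_eq_abs]
              exact mul_le_of_le_one_right (abs_nonneg γ) ContinuousLinearMap.norm_id_le
            · rw [← hDeq (Yp t) (hin t ht)]; exact hK _
    have hcont : ContinuousOn u (Icc 0 t₁) := fun t ht => (hu' t ht).continuousAt.continuousWithinAt
    have hut₁ : u t₁ = 0 := by simp [hu, hcurl₁]
    have hEq : EqOn u (fun _ => (0 : EuclideanSpace ℝ (Fin 3))) (Icc 0 t₁) :=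
      ODE_solution_unique_of_mem_Icc_left (v := fun t w => A t w) (s := fun _ => univ)
        (fun t ht => hKV t (Ioc_subset_Icc_self ht)) hcont
        (fun t ht => (hu' t (Ioc_subset_Icc_self ht)).hasDerivWithinAt) (fun _ _ => mem_univ _)
        continuousOn_const
        (fun t _ => by
          have h0 : HasDerivWithinAt (fun _ : ℝ => (0 : EuclideanSpace ℝ (Fin 3))) 0 (Iic t) t :=
            hasDerivWithinAt_const _ _ _
          simpa using h0)
        (fun _ _ => mem_univ _) (by simpa using hut₁)
    have hu0 : u 0 = 0 := hEq ⟨le_rfl, ht₁0⟩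
    have : curl U x = 0 := by simpa [hu, hYp0] using hu0
    exact hcx this
  have hnull := volume_vortical_confined_eq_zero hprof hγ hγ2 hR0
  have hopen : IsOpen {x : EuclideanSpace ℝ (Fin 3) | dist x x₀ < r ∧ curl U x ≠ 0} := by
    have h1 : IsOpen {x : EuclideanSpace ℝ (Fin 3) | dist x x₀ < r} := isOpen_lt (continuous_id.dist continuous_const) continuous_const
    exact h1.inter (isOpen_ne_fun (differentiable_curl_of_contDiff hU2).continuous continuous_const)
  have hzero : volume {x : EuclideanSpace ℝ (Fin 3) | dist x x₀ < r ∧ curl U x ≠ 0} = 0 := measure_mono_null hsubset hnull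
  have hempty := (hopen.measure_eq_zero_iff volume).1 hzero
  have hmem : x₀ ∈ ({x : EuclideanSpace ℝ (Fin 3) | dist x x₀ < r ∧ curl U x ≠ 0} : Set _) := ⟨by simp [hr0], hx₀⟩
  rw [hempty] at hmem
  exact hmem

/-- **Corollary: the transport-field form.**  Same hypotheses; the fast-inflow conclusion stated through `W = selfSimilarTransport γ 0 U`:
`⟪y, W y⟫ ≤ 0`. [folklore; cf. ConstantinIgnatovaVicol2026Putative §3.4.3] -/
theorem exists_inflow_vortical_bernoulli_gt (hprof : IsSelfSimilarEulerProfile γ 0 U P) (hγ : 0 < γ) (hγ2 : γ < 1 / 2)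
    {x₀ : EuclideanSpace ℝ (Fin 3)} (hx₀ : curl U x₀ ≠ 0) {h : ℝ} (hh : h < selfSimilarBernoulli γ 0 U P x₀)
    {R : ℝ} (hR : ‖x₀‖ < R) :
    ∃ y : EuclideanSpace ℝ (Fin 3), ‖y‖ = R ∧ ⟪y, selfSimilarTransport γ 0 U y⟫ ≤ 0 ∧ curl U y ≠ 0 ∧
      h < selfSimilarBernoulli γ 0 U P y := by
  obtain ⟨y, hy, hfast, hc, hH⟩ := exists_fastInflow_vortical_bernoulli_gt hprof hγ hγ2 hx₀ hh hR
  refine ⟨y, hy, ?_, hc, hH⟩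
  rw [selfSimilarTransport_apply, sub_zero, inner_add_right, inner_smul_right, real_inner_self_eq_norm_sq]
  linarith

end Summit.NavierStokesRegularity.NavierStokesRegularity.Theorems.PowerGaugeEulerLiouville.Loc

end
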